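import Literature.Analysis.FluidPDE.PeriodicCylinderTorusRepresentation
import Literature.Analysis.FluidPDE.TorusBilinearProducts
import Literature.Analysis.FunctionSpaces.SobolevTraceDensityHigherProofs
import Literature.Analysis.FluidPDE.CompressibleEulerLinearizedDerivative
import HarnessLib

/-!
# Tame cell bounds for the two quadratic forms of the pressure Neumann problem

Analysis/FluidPDE support file for the energy-method construction of Euler flows in the
periodic cylinder (`Literature.Analysis.FluidPDE.KatoLai1984_periodicCylinderUniformExistence`;
Kato–Lai 1984, §4 (4.4): the data of the pressure problem are bounded with one factor at the
low level `s₀`). For a field `w`, `C^∞` on the closed cylinder `{r ≤ 1}` and `L`-periodic in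
`z`, and every order `k`:

* `exists_eSobolevDomainNorm_gradSqTrace_le` —
  `‖∑ᵢⱼ (∂ᵢw)ⱼ(∂ⱼw)ᵢ‖_{W^{k,2}(cell)} ≤ C ‖w‖_{W^{3,2}(cell)} ‖w‖_{W^{k+1,2}(cell)}`;
* `exists_eSobolevDomainNorm_horizSq_le` —
  `‖ |w_h|² ‖_{W^{k,2}(cell)} ≤ C ‖w‖_{W^{2,2}(cell)} ‖w‖_{W^{k,2}(cell)}`,

(in `ℝ≥0∞`). Proof: both scalars are restrictions `fromTorus` of torus scalars built from the
torus representative `W = torusRep L w` (`PeriodicCylinderTorusRepresentation`), namely finite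
combinations of bilinear scalars `⟪A, M B⟫` of word derivatives of `W`; the restriction bound
`exists_eSobolevDomainNorm_fromTorus_le_wordEnergy` (`PeriodicCellRestriction`) reduces the cell
norm to the word energy on the torus, the 2-tame bound `exists_integral_wordDeriv_innerCLM_sq_le`
(`TorusBilinearProducts`) bounds it by lattice energies of `W`, and these are bounded by the cell
Sobolev norms of `w` (`exists_latNormSq_torusRep_le`).

Everything is proved; no named fact and no `sorry` is introduced.

## References

* T. Kato, C. Y. Lai, J. Funct. Anal. 56 (1984) 15–28, §4 (4.4). [KatoLai1984]
* R. Temam, J. Funct. Anal. 20 (1975) 32–43, Lemma 1.2. [Temam1975]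
-/

noncomputable section

open MeasureTheory Set Function Filter Topology TopologicalSpace WithLp Finset
open scoped ContDiff NNReal ENNReal InnerProductSpace RealInnerProductSpace

namespace Literature.Analysis.FluidPDE

open FunctionSpaces FunctionSpaces.Torus UnitAddTorus

/-- Local notation for physical space `ℝ³ = EuclideanSpace ℝ (Fin 3)`. -/
local notation "ℝ³" => EuclideanSpace ℝ (Fin 3)

/-- Local notation for the closed cylinder `{r ≤ 1}`. -/
local notation "𝕂" => closure (SetLike.coe unitCylinder : Set (EuclideanSpace ℝ (Fin 3)))

/-! ### Linearity of torus word derivatives -/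

namespace Torus

variable {d : Type*} [Fintype d] [DecidableEq d] {F : Type*} [NormedAddCommGroup F] [NormedSpace ℝ F]

/-- Word derivatives of finite sums of smooth functions. [folklore] -/
theorem wordDeriv_fun_sum {ι : Type*} (s : Finset ι) {f : ι → UnitAddTorus d → F} (hf : ∀ i ∈ s, IsSmooth (f i)) :
    ∀ w : List d, wordDeriv w (fun x => ∑ i ∈ s, f i x) = fun x => ∑ i ∈ s, wordDeriv w (f i) x
  | [] => rfl
  | a :: w => by
    funext x
    rw [wordDeriv_cons, wordDeriv_fun_sum s hf w,
      partialDeriv_finset_sum _ (fun i hi => (isSmooth_wordDeriv (hf i hi) w).isContDiff (by simp)) a x]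
    rfl

/-- Word derivatives of constant multiples, lambda form (local copy; the tree's
`Torus.wordDeriv_const_smul` of `TorusWordLeibniz` is the `Pi` form). [folklore] -/
theorem wordDeriv_fun_const_smul (c : ℝ) {f : UnitAddTorus d → F} (hf : IsSmooth f) :
    ∀ w : List d, wordDeriv w (fun x => c • f x) = fun x => c • wordDeriv w f x
  | [] => rfl
  | a :: w => by
    funext x
    rw [wordDeriv_cons, wordDeriv_fun_const_smul c hf w]
    have h := partialDeriv_const_smul ((isSmooth_wordDeriv hf w).isContDiff (by simp)) c a
    exact congr_fun h x

end Torus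

namespace PeriodicCylinder

variable {L : ℝ}

/-! ### The torus scalars as bilinear scalars -/

/-- The rank-one map `v ↦ vᵢ eⱼ`. [folklore] -/
def coordMap (i j : Fin 3) : ℝ³ →L[ℝ] ℝ³ := (EuclideanSpace.proj i : ℝ³ →L[ℝ] ℝ).smulRight (cylBasis j)

/-- `⟪A, coordMap i j B⟫ = Aⱼ Bᵢ`. [folklore] -/
theorem inner_coordMap (i j : Fin 3) (A B : ℝ³) : ⟪A, coordMap i j B⟫ = A j * B i := by
  rw [coordMap, ContinuousLinearMap.smulRight_apply, inner_smul_right, inner_cylBasis_right]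
  simp [mul_comm]

/-- `torusGradSqTrace` as a combination of bilinear scalars of the first word derivatives. [folklore] -/
theorem torusGradSqTrace_eq (L : ℝ) (W : UnitAddTorus (Fin 3) → ℝ³) :
    torusGradSqTrace L W = fun ξ => ∑ p : Fin 3 × Fin 3, ((boxSide L p.1)⁻¹ * (boxSide L p.2)⁻¹) •
      ⟪Torus.wordDeriv [p.1] W ξ, coordMap p.1 p.2 (Torus.wordDeriv [p.2] W ξ)⟫ := by
  funext ξ
  rw [torusGradSqTrace, ← Finset.univ_product_univ, Finset.sum_product]
  refine Finset.sum_congr rfl fun i _ => Finset.sum_congr rfl fun j _ => ?_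
  rw [inner_coordMap, smul_eq_mul]

/-- `torusHorizSq` as a bilinear scalar. [folklore] -/
theorem torusHorizSq_eq (W : UnitAddTorus (Fin 3) → ℝ³) :
    torusHorizSq W = fun ξ => ⟪W ξ, horizontalProjL (W ξ)⟫ := by
  funext ξ
  rw [torusHorizSq, horizontalProjL_apply, inner_horizontalProj_self]

/-- `torusGradSqTrace` of a smooth field is smooth. [folklore] -/
theorem isSmooth_torusGradSqTrace (L : ℝ) {W : UnitAddTorus (Fin 3) → ℝ³} (hW : IsSmooth W) : IsSmooth (torusGradSqTrace L W) := by
  rw [torusGradSqTrace_eq]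
  refine CompressibleEuler.isSmooth_fun_sum _ fun p _ => ?_
  exact ((Torus.isSmooth_wordDeriv hW _).inner ((Torus.isSmooth_wordDeriv hW _).comp_clm _)).smul _

/-- `torusHorizSq` of a smooth field is smooth. [folklore] -/
theorem isSmooth_torusHorizSq {W : UnitAddTorus (Fin 3) → ℝ³} (hW : IsSmooth W) : IsSmooth (torusHorizSq W) := by
  rw [torusHorizSq_eq]
  exact hW.inner (hW.comp_clm _)

/-! ### Word energies of the torus scalars -/

/-- Cauchy–Schwarz for a finite sum of functions in `L²`: `∫ (∑ₚ gₚ)² ≤ #P ∑ₚ ∫ gₚ²`. [folklore] -/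
theorem integral_sq_sum_le {ι : Type*} (s : Finset ι) {g : ι → UnitAddTorus (Fin 3) → ℝ}
    (hg : ∀ p ∈ s, Continuous (g p)) :
    ∫ ξ, (∑ p ∈ s, g p ξ) ^ 2 ≤ s.card * ∑ p ∈ s, ∫ ξ, g p ξ ^ 2 := by
  have hint : ∀ p ∈ s, Integrable (fun ξ => g p ξ ^ 2) volume := fun p hp => ((hg p hp).pow 2).integrable_unitAddTorus
  calc ∫ ξ, (∑ p ∈ s, g p ξ) ^ 2 ≤ ∫ ξ, s.card * ∑ p ∈ s, g p ξ ^ 2 :=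
        integral_mono_of_nonneg (ae_of_all _ fun ξ => sq_nonneg _) ((integrable_finsetSum _ hint).const_mul _)
          (ae_of_all _ fun ξ => sq_sum_le_card_mul_sum_sq)
    _ = s.card * ∑ p ∈ s, ∫ ξ, g p ξ ^ 2 := by rw [integral_const_mul, integral_finsetSum _ hint]

/-- **Word energy of `torusGradSqTrace`**: `∫ |∂_r torusGradSqTrace|² ≤ C lat₃(W) lat_{k+1}(W)` for
`|r| ≤ k`. [folklore] -/
theorem exists_integral_wordDeriv_torusGradSqTrace_sq_le (L : ℝ) (k : ℕ) : ∃ C : ℝ, 0 ≤ C ∧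
    ∀ (W : UnitAddTorus (Fin 3) → ℝ³), IsSmooth W → ∀ r : List (Fin 3), r.length ≤ k →
      ∫ ξ, (Torus.wordDeriv r (torusGradSqTrace L W) ξ) ^ 2 ≤ C * (Torus.latNormSq 3 W * Torus.latNormSq (k + 1) W) := by
  obtain ⟨C, hC0, hC⟩ := Torus.exists_integral_wordDeriv_innerCLM_sq_le (d := Fin 3) (by simp) k
  set q : ℝ := 4 * Real.pi ^ 2 with hq
  -- the constant: 9 pairs, coefficients, `‖M‖²`, two shifts by `q`
  set K : ℝ := ∑ p : Fin 3 × Fin 3, ((boxSide L p.1)⁻¹ * (boxSide L p.2)⁻¹) ^ 2 * (C * ‖coordMap p.1 p.2‖ ^ 2) with hK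
  have hK0 : 0 ≤ K := sum_nonneg fun p _ => by positivity
  refine ⟨(Fintype.card (Fin 3 × Fin 3) : ℝ) * K * (2 * q * q), by positivity, fun W hW r hr => ?_⟩
  have h3 := Torus.latNormSq_nonneg 3 W
  have hk1 := Torus.latNormSq_nonneg (k + 1) W
  -- the terms
  set g : Fin 3 × Fin 3 → UnitAddTorus (Fin 3) → ℝ := fun p ξ => ((boxSide L p.1)⁻¹ * (boxSide L p.2)⁻¹) •
    Torus.wordDeriv r (fun η => ⟪Torus.wordDeriv [p.1] W η, coordMap p.1 p.2 (Torus.wordDeriv [p.2] W η)⟫) ξ with hg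
  have hterm_s : ∀ p : Fin 3 × Fin 3, IsSmooth (fun η => ⟪Torus.wordDeriv [p.1] W η, coordMap p.1 p.2 (Torus.wordDeriv [p.2] W η)⟫) :=
    fun p => (Torus.isSmooth_wordDeriv hW _).inner ((Torus.isSmooth_wordDeriv hW _).comp_clm _)
  have hderiv : Torus.wordDeriv r (torusGradSqTrace L W) = fun ξ => ∑ p : Fin 3 × Fin 3, g p ξ := by
    rw [torusGradSqTrace_eq, Torus.wordDeriv_fun_sum (f := fun (p : Fin 3 × Fin 3) (ξ : UnitAddTorus (Fin 3)) =>
      ((boxSide L p.1)⁻¹ * (boxSide L p.2)⁻¹) •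
      ⟪Torus.wordDeriv [p.1] W ξ, coordMap p.1 p.2 (Torus.wordDeriv [p.2] W ξ)⟫) _ (fun p _ => by exact (hterm_s p).smul _) r]
    funext ξ
    refine Finset.sum_congr rfl fun p _ => ?_
    rw [hg]
    exact congr_fun (Torus.wordDeriv_fun_const_smul _ (hterm_s p) r) ξ
  have hgc : ∀ p ∈ (univ : Finset (Fin 3 × Fin 3)), Continuous (g p) := fun p _ => by
    simp only [hg]
    exact ((Torus.isSmooth_wordDeriv (hterm_s p) r).continuous).const_smul ((boxSide L p.1)⁻¹ * (boxSide L p.2)⁻¹)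
  -- each term
  have hgb : ∀ p : Fin 3 × Fin 3, ∫ ξ, g p ξ ^ 2 ≤
      ((boxSide L p.1)⁻¹ * (boxSide L p.2)⁻¹) ^ 2 * (C * ‖coordMap p.1 p.2‖ ^ 2) * (2 * q * q * (Torus.latNormSq 3 W * Torus.latNormSq (k + 1) W)) := by
    intro p
    have hA := Torus.isSmooth_wordDeriv hW [p.1]
    have hB := Torus.isSmooth_wordDeriv hW [p.2]
    have h1 := hC _ _ hA hB (coordMap p.1 p.2) r hr
    have hs2A : Torus.latNormSq 2 (Torus.wordDeriv [p.1] W) ≤ q * Torus.latNormSq 3 W := by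
      have := Torus.latNormSq_wordDeriv_le hW 2 [p.1]; simpa using this
    have hskB : Torus.latNormSq k (Torus.wordDeriv [p.2] W) ≤ q * Torus.latNormSq (k + 1) W := by
      have := Torus.latNormSq_wordDeriv_le hW k [p.2]; simpa using this
    have hskA : Torus.latNormSq k (Torus.wordDeriv [p.1] W) ≤ q * Torus.latNormSq (k + 1) W := by
      have := Torus.latNormSq_wordDeriv_le hW k [p.1]; simpa using this
    have hs2B : Torus.latNormSq 2 (Torus.wordDeriv [p.2] W) ≤ q * Torus.latNormSq 3 W := by
      have := Torus.latNormSq_wordDeriv_le hW 2 [p.2]; simpa using this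
    have h2A := Torus.latNormSq_nonneg 2 (Torus.wordDeriv [p.1] W)
    have hkA := Torus.latNormSq_nonneg k (Torus.wordDeriv [p.1] W)
    have h2B := Torus.latNormSq_nonneg 2 (Torus.wordDeriv [p.2] W)
    have hkB := Torus.latNormSq_nonneg k (Torus.wordDeriv [p.2] W)
    have hprod : Torus.latNormSq 2 (Torus.wordDeriv [p.1] W) * Torus.latNormSq k (Torus.wordDeriv [p.2] W) +
        Torus.latNormSq k (Torus.wordDeriv [p.1] W) * Torus.latNormSq 2 (Torus.wordDeriv [p.2] W) ≤
        2 * q * q * (Torus.latNormSq 3 W * Torus.latNormSq (k + 1) W) := by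
      have e1 := mul_le_mul hs2A hskB hkB (by positivity)
      have e2 := mul_le_mul hskA hs2B h2B (by positivity)
      nlinarith [e1, e2]
    have hsq : ∀ ξ, g p ξ ^ 2 = ((boxSide L p.1)⁻¹ * (boxSide L p.2)⁻¹) ^ 2 *
        (Torus.wordDeriv r (fun η => ⟪Torus.wordDeriv [p.1] W η, coordMap p.1 p.2 (Torus.wordDeriv [p.2] W η)⟫) ξ) ^ 2 :=
      fun ξ => by rw [hg]; dsimp only; rw [smul_eq_mul, mul_pow]
    simp only [hsq]
    rw [integral_const_mul]
    rw [mul_assoc]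
    refine mul_le_mul_of_nonneg_left ?_ (sq_nonneg _)
    exact h1.trans (mul_le_mul_of_nonneg_left hprod (by positivity))
  rw [hderiv]
  calc ∫ ξ, (∑ p : Fin 3 × Fin 3, g p ξ) ^ 2 ≤ (univ : Finset (Fin 3 × Fin 3)).card * ∑ p : Fin 3 × Fin 3, ∫ ξ, g p ξ ^ 2 :=
        integral_sq_sum_le _ hgc
    _ ≤ (Fintype.card (Fin 3 × Fin 3) : ℝ) * ∑ p : Fin 3 × Fin 3,
          ((boxSide L p.1)⁻¹ * (boxSide L p.2)⁻¹) ^ 2 * (C * ‖coordMap p.1 p.2‖ ^ 2) * (2 * q * q * (Torus.latNormSq 3 W * Torus.latNormSq (k + 1) W)) := by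
        rw [card_univ]
        exact mul_le_mul_of_nonneg_left (sum_le_sum fun p _ => hgb p) (Nat.cast_nonneg _)
    _ = (Fintype.card (Fin 3 × Fin 3) : ℝ) * K * (2 * q * q) * (Torus.latNormSq 3 W * Torus.latNormSq (k + 1) W) := by
        rw [hK, ← sum_mul]; ring

/-- **Word energy of `torusHorizSq`**: `∫ |∂_r |W_h|²|² ≤ C lat₂(W) lat_k(W)` for `|r| ≤ k`. [folklore] -/
theorem exists_integral_wordDeriv_torusHorizSq_sq_le (k : ℕ) : ∃ C : ℝ, 0 ≤ C ∧
    ∀ (W : UnitAddTorus (Fin 3) → ℝ³), IsSmooth W → ∀ r : List (Fin 3), r.length ≤ k →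
      ∫ ξ, (Torus.wordDeriv r (torusHorizSq W) ξ) ^ 2 ≤ C * (Torus.latNormSq 2 W * Torus.latNormSq k W) := by
  obtain ⟨C, hC0, hC⟩ := Torus.exists_integral_wordDeriv_innerCLM_sq_le (d := Fin 3) (by simp) k
  refine ⟨2 * C * ‖horizontalProjL‖ ^ 2, by positivity, fun W hW r hr => ?_⟩
  have h := hC W W hW hW horizontalProjL r hr
  rw [torusHorizSq_eq]
  calc ∫ ξ, (Torus.wordDeriv r (fun ξ => ⟪W ξ, horizontalProjL (W ξ)⟫) ξ) ^ 2
      ≤ C * ‖horizontalProjL‖ ^ 2 * (Torus.latNormSq 2 W * Torus.latNormSq k W + Torus.latNormSq k W * Torus.latNormSq 2 W) := h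
    _ = 2 * C * ‖horizontalProjL‖ ^ 2 * (Torus.latNormSq 2 W * Torus.latNormSq k W) := by ring

/-- Word energies from the single-word bounds. [folklore] -/
theorem wordEnergy_le_of_forall {k : ℕ} {V : UnitAddTorus (Fin 3) → ℝ} {B : ℝ}
    (h : ∀ r : List (Fin 3), r.length ≤ k → ∫ ξ, (Torus.wordDeriv r V ξ) ^ 2 ≤ B) :
    wordEnergy k V ≤ (∑ l ∈ range (k + 1), (Fintype.card (Fin l → Fin 3) : ℝ)) * B := by
  unfold wordEnergy
  rw [sum_mul]
  refine sum_le_sum fun l hl => ?_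
  have hlk : l ≤ k := Nat.lt_succ_iff.1 (mem_range.1 hl)
  calc ∑ r : Fin l → Fin 3, ∫ ξ, ‖Torus.wordDeriv (List.ofFn r) V ξ‖ ^ 2 ≤ ∑ _r : Fin l → Fin 3, B := by
        refine sum_le_sum fun r _ => ?_
        have := h (List.ofFn r) (by rw [List.length_ofFn]; exact hlk)
        simpa only [Real.norm_eq_abs, sq_abs] using this
    _ = _ := by rw [sum_const, card_univ, nsmul_eq_mul]

/-! ### The cell bounds -/

/-- `√(c E²) = √c · E` for `E ≥ 0`, bookkeeping. [folklore] -/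
theorem sqrt_mul_sq_eq {c E : ℝ} (hc : 0 ≤ c) (hE : 0 ≤ E) : Real.sqrt (c * E ^ 2) = Real.sqrt c * E := by
  rw [Real.sqrt_mul hc, Real.sqrt_sq hE]

/-- **Tame cell bound for `∑ᵢⱼ (∂ᵢw)ⱼ(∂ⱼw)ᵢ`**:
`‖gradSqTrace w‖_{W^{k,2}(cell)} ≤ C ‖w‖_{W^{3,2}(cell)} ‖w‖_{W^{k+1,2}(cell)}`. [cite: KatoLai1984, §4 (4.4)] -/
theorem exists_eSobolevDomainNorm_gradSqTrace_le (hL : 0 < L) (k : ℕ) : ∃ C : ℝ, 0 ≤ C ∧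
    ∀ (w : ℝ³ → ℝ³), IsSmoothPeriodic L w →
      eSobolevDomainNorm k 2 (cylinderCell L) volume (gradSqTrace w) ≤
        ENNReal.ofReal C * eSobolevDomainNorm 3 2 (cylinderCell L) volume w *
          eSobolevDomainNorm (k + 1) 2 (cylinderCell L) volume w := by
  obtain ⟨CT, hCT0, hCT⟩ := exists_eSobolevDomainNorm_fromTorus_le_wordEnergy (F := ℝ) hL k
  obtain ⟨CW, hCW0, hCW⟩ := exists_integral_wordDeriv_torusGradSqTrace_sq_le L k
  obtain ⟨C₃, hC₃0, hC₃⟩ := exists_latNormSq_torusRep_le hL 3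
  obtain ⟨Ck, hCk0, hCk⟩ := exists_latNormSq_torusRep_le hL (k + 1)
  set N : ℝ := ∑ l ∈ range (k + 1), (Fintype.card (Fin l → Fin 3) : ℝ) with hN
  have hN0 : 0 ≤ N := sum_nonneg fun _ _ => Nat.cast_nonneg _
  refine ⟨CT * Real.sqrt (N * CW) * Real.sqrt C₃ * Real.sqrt Ck, by positivity, fun w hw => ?_⟩
  set W := torusRep L w with hWdef
  have hW : IsSmooth W := isSmooth_torusRep hw
  set E₃ := eSobolevDomainNorm 3 2 (cylinderCell L) volume w with hE₃
  set Ek := eSobolevDomainNorm (k + 1) 2 (cylinderCell L) volume w with hEk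
  have hE₃f : E₃ < ⊤ := eSobolevDomainNorm_lt_top_of_isSmoothPeriodic L 3 hw.smooth
  have hEkf : Ek < ⊤ := eSobolevDomainNorm_lt_top_of_isSmoothPeriodic L (k + 1) hw.smooth
  -- the cell norm only sees the open cell, where `gradSqTrace w = fromTorus (torusGradSqTrace W)`
  have hcongr : eSobolevDomainNorm k 2 (cylinderCell L) volume (gradSqTrace w) =
      eSobolevDomainNorm k 2 (cylinderCell L) volume (fromTorus L (torusGradSqTrace L W)) :=
    SobolevApprox.eSobolevDomainNorm_congr (Ω := cylinderCell L) (p := 2) (μ := volume) fun x hx =>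
      gradSqTrace_eq_fromTorus hL hw (cylinderCell_le_unitCylinder L hx)
  rw [hcongr]
  refine (hCT _ (isSmooth_torusGradSqTrace L hW)).trans ?_
  -- the word energy by lattice energies, and these by the cell norms
  have hWE : wordEnergy k (torusGradSqTrace L W) ≤ N * (CW * (Torus.latNormSq 3 W * Torus.latNormSq (k + 1) W)) :=
    wordEnergy_le_of_forall (hCW W hW)
  have hl3 := hC₃ w hw
  have hlk := hCk w hw
  have h3n := Torus.latNormSq_nonneg 3 W
  have hkn := Torus.latNormSq_nonneg (k + 1) W
  have hsq : Real.sqrt (wordEnergy k (torusGradSqTrace L W)) ≤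
      Real.sqrt (N * CW) * (Real.sqrt C₃ * E₃.toReal) * (Real.sqrt Ck * Ek.toReal) := by
    calc Real.sqrt (wordEnergy k (torusGradSqTrace L W))
        ≤ Real.sqrt (N * CW * (Torus.latNormSq 3 W * Torus.latNormSq (k + 1) W)) := Real.sqrt_le_sqrt (by rw [mul_assoc]; exact hWE)
      _ = Real.sqrt (N * CW) * (Real.sqrt (Torus.latNormSq 3 W) * Real.sqrt (Torus.latNormSq (k + 1) W)) := by
          rw [Real.sqrt_mul (by positivity), Real.sqrt_mul h3n]
      _ ≤ Real.sqrt (N * CW) * (Real.sqrt (C₃ * E₃.toReal ^ 2) * Real.sqrt (Ck * Ek.toReal ^ 2)) :=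
          mul_le_mul_of_nonneg_left (mul_le_mul (Real.sqrt_le_sqrt hl3) (Real.sqrt_le_sqrt hlk) (Real.sqrt_nonneg _)
            (Real.sqrt_nonneg _)) (Real.sqrt_nonneg _)
      _ = _ := by rw [sqrt_mul_sq_eq hC₃0 ENNReal.toReal_nonneg, sqrt_mul_sq_eq hCk0 ENNReal.toReal_nonneg]; ring
  calc ENNReal.ofReal (CT * Real.sqrt (wordEnergy k (torusGradSqTrace L W)))
      ≤ ENNReal.ofReal (CT * (Real.sqrt (N * CW) * (Real.sqrt C₃ * E₃.toReal) * (Real.sqrt Ck * Ek.toReal))) :=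
        ENNReal.ofReal_le_ofReal (mul_le_mul_of_nonneg_left hsq hCT0)
    _ = ENNReal.ofReal (CT * Real.sqrt (N * CW) * Real.sqrt C₃ * Real.sqrt Ck) * E₃ * Ek := by
        rw [show CT * (Real.sqrt (N * CW) * (Real.sqrt C₃ * E₃.toReal) * (Real.sqrt Ck * Ek.toReal)) =
          (CT * Real.sqrt (N * CW) * Real.sqrt C₃ * Real.sqrt Ck) * E₃.toReal * Ek.toReal by ring,
          ENNReal.ofReal_mul (by positivity), ENNReal.ofReal_mul (by positivity), ENNReal.ofReal_toReal hE₃f.ne,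
          ENNReal.ofReal_toReal hEkf.ne]

/-- **Tame cell bound for `|w_h|²`**:
`‖ |w_h|² ‖_{W^{k,2}(cell)} ≤ C ‖w‖_{W^{2,2}(cell)} ‖w‖_{W^{k,2}(cell)}`. [cite: KatoLai1984, §4 (4.4)] -/
theorem exists_eSobolevDomainNorm_horizSq_le (hL : 0 < L) (k : ℕ) : ∃ C : ℝ, 0 ≤ C ∧
    ∀ (w : ℝ³ → ℝ³), IsSmoothPeriodic L w →
      eSobolevDomainNorm k 2 (cylinderCell L) volume (fun x => ‖horizontalProj (w x)‖ ^ 2) ≤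
        ENNReal.ofReal C * eSobolevDomainNorm 2 2 (cylinderCell L) volume w *
          eSobolevDomainNorm k 2 (cylinderCell L) volume w := by
  obtain ⟨CT, hCT0, hCT⟩ := exists_eSobolevDomainNorm_fromTorus_le_wordEnergy (F := ℝ) hL k
  obtain ⟨CW, hCW0, hCW⟩ := exists_integral_wordDeriv_torusHorizSq_sq_le k
  obtain ⟨C₂, hC₂0, hC₂⟩ := exists_latNormSq_torusRep_le hL 2
  obtain ⟨Ck, hCk0, hCk⟩ := exists_latNormSq_torusRep_le hL k
  set N : ℝ := ∑ l ∈ range (k + 1), (Fintype.card (Fin l → Fin 3) : ℝ) with hN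
  have hN0 : 0 ≤ N := sum_nonneg fun _ _ => Nat.cast_nonneg _
  refine ⟨CT * Real.sqrt (N * CW) * Real.sqrt C₂ * Real.sqrt Ck, by positivity, fun w hw => ?_⟩
  set W := torusRep L w with hWdef
  have hW : IsSmooth W := isSmooth_torusRep hw
  set E₂ := eSobolevDomainNorm 2 2 (cylinderCell L) volume w with hE₂
  set Ek := eSobolevDomainNorm k 2 (cylinderCell L) volume w with hEk
  have hE₂f : E₂ < ⊤ := eSobolevDomainNorm_lt_top_of_isSmoothPeriodic L 2 hw.smooth
  have hEkf : Ek < ⊤ := eSobolevDomainNorm_lt_top_of_isSmoothPeriodic L k hw.smooth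
  have hcongr : eSobolevDomainNorm k 2 (cylinderCell L) volume (fun x => ‖horizontalProj (w x)‖ ^ 2) =
      eSobolevDomainNorm k 2 (cylinderCell L) volume (fromTorus L (torusHorizSq W)) :=
    SobolevApprox.eSobolevDomainNorm_congr (Ω := cylinderCell L) (p := 2) (μ := volume) fun x hx =>
      norm_horizontalProj_sq_eq_fromTorus hL hw.periodic (subset_closure (cylinderCell_le_unitCylinder L hx))
  rw [hcongr]
  refine (hCT _ (isSmooth_torusHorizSq hW)).trans ?_
  have hWE : wordEnergy k (torusHorizSq W) ≤ N * (CW * (Torus.latNormSq 2 W * Torus.latNormSq k W)) :=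
    wordEnergy_le_of_forall (hCW W hW)
  have hl2 := hC₂ w hw
  have hlk := hCk w hw
  have h2n := Torus.latNormSq_nonneg 2 W
  have hkn := Torus.latNormSq_nonneg k W
  have hsq : Real.sqrt (wordEnergy k (torusHorizSq W)) ≤
      Real.sqrt (N * CW) * (Real.sqrt C₂ * E₂.toReal) * (Real.sqrt Ck * Ek.toReal) := by
    calc Real.sqrt (wordEnergy k (torusHorizSq W))
        ≤ Real.sqrt (N * CW * (Torus.latNormSq 2 W * Torus.latNormSq k W)) := Real.sqrt_le_sqrt (by rw [mul_assoc]; exact hWE)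
      _ = Real.sqrt (N * CW) * (Real.sqrt (Torus.latNormSq 2 W) * Real.sqrt (Torus.latNormSq k W)) := by
          rw [Real.sqrt_mul (by positivity), Real.sqrt_mul h2n]
      _ ≤ Real.sqrt (N * CW) * (Real.sqrt (C₂ * E₂.toReal ^ 2) * Real.sqrt (Ck * Ek.toReal ^ 2)) :=
          mul_le_mul_of_nonneg_left (mul_le_mul (Real.sqrt_le_sqrt hl2) (Real.sqrt_le_sqrt hlk) (Real.sqrt_nonneg _)
            (Real.sqrt_nonneg _)) (Real.sqrt_nonneg _)
      _ = _ := by rw [sqrt_mul_sq_eq hC₂0 ENNReal.toReal_nonneg, sqrt_mul_sq_eq hCk0 ENNReal.toReal_nonneg]; ring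
  calc ENNReal.ofReal (CT * Real.sqrt (wordEnergy k (torusHorizSq W)))
      ≤ ENNReal.ofReal (CT * (Real.sqrt (N * CW) * (Real.sqrt C₂ * E₂.toReal) * (Real.sqrt Ck * Ek.toReal))) :=
        ENNReal.ofReal_le_ofReal (mul_le_mul_of_nonneg_left hsq hCT0)
    _ = ENNReal.ofReal (CT * Real.sqrt (N * CW) * Real.sqrt C₂ * Real.sqrt Ck) * E₂ * Ek := by
        rw [show CT * (Real.sqrt (N * CW) * (Real.sqrt C₂ * E₂.toReal) * (Real.sqrt Ck * Ek.toReal)) =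
          (CT * Real.sqrt (N * CW) * Real.sqrt C₂ * Real.sqrt Ck) * E₂.toReal * Ek.toReal by ring,
          ENNReal.ofReal_mul (by positivity), ENNReal.ofReal_mul (by positivity), ENNReal.ofReal_toReal hE₂f.ne,
          ENNReal.ofReal_toReal hEkf.ne]

end PeriodicCylinder

end Literature.Analysis.FluidPDE
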